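import Summits.HodgeConjecture.HodgeConjecture.Cruxes.BlochSeedDiscOne.SeedChecker
import Literature.AlgebraicGeometry.HodgeTheory.WeilCharacterDecomposition
import Literature.AlgebraicGeometry.HodgeTheory.WeilClassesProducts
import Literature.AlgebraicGeometry.HodgeTheory.ExpTwistClassesExponentialLaw
import Literature.AlgebraicGeometry.Motives.AbelianVarietyCohomologyExteriorH1

/-!
# `Cruxes/BlochSeedDiscOne/SeedCheckerPrimitive.lean` — SEED CHECKER v13 (§16): THE WEIL PLANE IS `h`-PRIMITIVE
# (`w ∪ h = 0` already in `H¹⁰(S⁴)`, hence `w ∪ hʲ = 0` for every `j ≥ 1`, for every Weil class `w` and every `K`-balanced `h` —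
# the stub's own `h_K = symH ψ e a` for EVERY `(e, a)` and the frame's `h_std`), OFF-BOX VANISHING of the `K`-characters in EVERY
# degree, the C5 SHAPE predicate with its exact Lefschetz and `K`-isotypic shadows, and the ALIVE test `μ ≠ 0 ↔ σ ∪ σ ≠ q²·h⁸`
# under the NAMED anisotropy of the rational Weil plane

`line stmt-HodgeConjecture-18881 Cruxes/BlochSeedDiscOne/Lines/birth.lean 814a6a70c14e831a stub_rung_pad4_seedAt` · explicit unit
`hsemireg-c5c8-1` (g12; director MINT A5: C5–C8 typed as predicates on (design json, presentation)) · **a SATELLITE of `SeedChecker.lean`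
v4 (`13437bb9848c3c36`, the built member of the family) in the NEW sub-namespace**
`Summit.HodgeConjecture.HodgeConjecture.Cruxes.BlochSeedDiscOne.SeedChecker.Primitive` — it imports ONLY v4 plus four BUILT Literature
modules (`WeilCharacterDecomposition`, `WeilClassesProducts`, `ExpTwistClassesExponentialLaw`, `Motives.AbelianVarietyCohomologyExteriorH1`);
it does NOT import the satellites v5 `SeedCheckerPorteous`, v6.2 `SeedCheckerKit`, v7.1 `SeedCheckerFrame`, v8 `SeedCheckerBalanced`, v9
`SeedCheckerDescent`, v10 `SeedCheckerWords`, v11.1 `SeedCheckerOneAnchor`, v12 `SeedCheckerDegree` (farm snapshot: `lean check` of an import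
probe answers rc 75 `remote:stale:…:unbuilt` for all of them at 2026-08-30T03:1xZ), and every declaration lives in the sub-namespace
`…SeedChecker.Primitive`, so no name of v4–v12 is shadowed or redeclared (the character `chi d a b` is v12's `bideg d a b` by `rfl`).

## Honest framing (mandatory)

NOTHING in this file is proved toward HC ∕ HC_CM ∕ HC_AV ∕ №4 ∕ 26512 ∕ 18881 ∕ H2. It contains no `sorry`, constructs no bundle,
section, zero scheme, frame or seed, and touches no stub: `stub_rung_pad4_seedAt` is neither weakened nor specialised — only the
CLASSES named in its conclusion (`symH (pad4Action E₀ ψ₀) e a` for ARBITRARY `(e, a)`, and `w ∈ weilClassesOf … 4 1`) are studied. The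
seat produces evidence and typed files, not rungs. §16.1–§16.5 are UNCONDITIONAL linear algebra on the Betti carrier over the tree's
`K`-character decomposition (`iSup_pullbackEigenclasses_weilCharacter_eq_top`, `exists_pos_nat_separating_weilCharacters`,
`pullbackEigenclasses_le_eigenspace`, `cupProduct_mem_pullbackEigenclasses`, `cupProduct_gradedComm_holds`); §16.6 is a door whose one
positivity input (anisotropy ∕ Hodge–Riemann sign of the RATIONAL Weil plane) is a NAMED HYPOTHESIS, not proved.

## What v13 adds (all additive; no declaration of v4 is changed)

§16.1 **OFF-BOX VANISHING IN EVERY DEGREE** (generic: `A` an abelian variety, `φ ≫ φ = -d`, `d ≥ 1`). `eq_zero_of_mem_chi_offBox`: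
an eigenclass `c ∈ Hᵏ(A(ℂ); ℂ)` of the character `χ_{a,b}`, `a + b = k`, with `a > dim A` or `b > dim A` is `0` (`⋀ᵃV₊ = 0` for
`a > dim V₊ = dim A`). Carrier proof: ONE test isogeny `x₀·𝟙 + φ` separates ALL characters of total degree `k` (`uᵐ ≠ ūᵐ` for
`1 ≤ m ≤ k`, from the tree's `exists_pos_nat_separating_weilCharacters hd (k + 1)`); the polynomial `∏_{a'+b'=k, a',b' ≤ g}(X − χ_{a',b'}(x₀, 1))`
in that pull-back kills `Hᵏ = Σ χ_{a',b'}` and acts on `c` by a NON-ZERO scalar. (v12 had only the top-degree case `k = 2g`.)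
§16.2 **`W ∪ χ_{a,b} = 0 = χ_{a,b} ∪ W` for `a, b ≥ 1` in EVERY degree** on a `2n`-fold (`E₊ ∪ χ_{a,b} ⊆ χ_{2n+a,b}`, off-box); `W ∪ (mixed span) = 0`;
and **`χ_{a,b} ∩ W = 0`** for every non-extreme character of degree `2n` (`eq_zero_of_mem_chi_of_mem_weilClassesOf`: ONE quadratic in ONE
test pull-back kills `W` and scales `χ_{a,b}` by a non-zero number).
§16.3 **`h`-PRIMITIVITY OF THE WEIL PLANE**: for every `K`-balanced `h ∈ χ_{1,1} ⊆ H²` and every Weil class `w ∈ W ⊆ H²ⁿ`: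
**`w ∪ h = 0` in `H^{2n+2}`**, `w ∪ hʲ = 0` (`j ≥ 1`), `h ∪ w = 0`, `hʲ ∪ w = 0` — one line from van Geemen's Lemma 5.2 (a Weil-type polarisation `E` has `(√−d)^*E = dE`, i.e. `E ∈ χ_{1,1}`) and 6.10 (`W, W̄ ⊆ H¹ ⊗ ℂ` are
`E`-isotropic): `⋀^{2n}W ∧ E ⊆ ⋀^{2n+1}W ⊗ W̄ = 0`, «the Weil classes are `E`-primitive», here on the carrier; v12's `w ∪ h⁴ = 0` in `H¹⁶(S⁴)` is the case `j = n = 4`. `d·c + ψ^*c ∈ χ_{1,1}` for every `c ∈ H²` (re-derived here as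
`natCast_smul_add_map_mem_chi`, v12's proof, since v12 is unimportable), so the stub's `h_K = symH ψ e a` is balanced for EVERY `(e, a)`.
§16.4 On the anchor `S⁴ = pad4Anchor E₀` (`n = 4`, `d = 1`): `pad4_weil_cupProduct_symH_eq_zero` (**`w ∪ h_K = 0` in `H¹⁰(S⁴)` for EVERY
`(e, a)`**), `…_symHPow_…` (`w ∪ h_Kʲ = 0`, `j ≥ 1`), the `h_std` and `wOf μ` instances, both orders.
§16.5 **THE C5 SHAPE, TYPED.** `ShapeAt F h x` («`x = q·h⁴ + wOf μ` for some `q ∈ ℚ`, `μ ∈ ℤ[i]`»: `x` lies on the C5 lattice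
`ℚ·h⁴ ⊕ W_K`) and `AliveAt F h x` (the same with `μ ≠ 0`) — predicates on a CLASS `x ∈ H⁸(S⁴)` (the presentation's `cl(Z)`, or `ch₄(𝓔)`
of the sheaf door), separate from the three numbers `Z·Z`, `Z·h⁴`, `h⁸` (critic w1). Exact shadows: LEFSCHETZ — `ShapeAt ⟹ x ∪ hʲ = q·h^{4+j}`
for `j ≥ 1` (`ShapeAt.cupProduct_hPow`; at `j = 1`: **`x ∪ h ∈ ℂ·h⁵`**, i.e. the `h`-primitive part of `x − q h⁴` is all of it; at `j = 4`
v12's degree reading); WELL-DEFINEDNESS — `ShapeAt.coords_unique`: **the pair `(q, μ)` of a shaped class is unique** (`h⁴ ≠ 0`; via `χ_{4,4} ∩ W = 0` and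
`wOf_injective`), so «the `μ` read off `cl(Z)` equals the design's `μ`» (the σ-check) is a predicate, and `aliveAt_iff_shapeAt_and_not_hPow`:
**ALIVE ⟺ SHAPED ∧ `x ∉ ℚ·h⁴`** («non-divisor-power class»); `K`-ISOTYPIC — `ShapeAt ⟹ x ∈ χ_{4,4} ⊔ W` (`ShapeAt.mem_sup`) and the SHAPE POLYNOMIAL
`(X − χ_{4,4}(x₀,1))(X − χ_{8,0}(x₀,1))(X − χ_{0,8}(x₀,1))` in ONE test pull-back kills `x` (`aeval_shapePoly_eq_zero_of_shapeAt`: an exact,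
period-free, json-computable necessary test on the `K`-module generated by `cl(Z)`); BLINDNESS — `numbers_blind_to_isotropic_primitive`:
adding to `σ = q·h⁴ + wOf μ` ANY class `p` with `p ∪ h⁴ = 0`, `p ∪ wOf μ = 0`, `p ∪ p = 0` changes none of `σ ∪ h⁴`, `σ ∪ σ` — so NO finite
list of intersection numbers certifies SHAPE (it is a linear condition of codimension `dim χ_{4,4} − 1 = 4899` inside `χ_{4,4} ⊔ W`, plus the
vanishing of the other `K`-isotypic components).
§16.6 **ALIVE TEST (door, degree-functional-free).** `classC5_sq`: `σ ∪ σ = q²·h⁸ + wOf μ ∪ wOf μ` (block diagonal). Under the NAMED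
anisotropy of the rational Weil plane `WeilAnisotropic` («`x ∪ x ≠ 0` for rational `x ∈ W ∖ 0`» — Hodge–Riemann: the Weil classes are
primitive of type `(4,4)`, so the HR form is DEFINITE on `W_ℝ`; an INPUT here): **`μ ≠ 0 ↔ σ ∪ σ ≠ q²·h⁸`** (`mu_ne_zero_iff_sq_ne`) — the
design half of C5 read AT THE SEED from `Z·Z` against `q²·h⁸`, with no orientation, no `deg_h`, no `h⁸ ≠ 0` (v12 needed all three).

## C5–C8 flags added by v13 (cumulative table in the memo `SEED-CHECKER-C5C8-c5c8-1-g12.md` §3)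

* C5 SHAPE (new row): NOT implied by C0–C4 and NOT certifiable by any finite set of `h`-numbers ∕ Gram data (§16.5 blindness); implied on
  the DESIGN ROAD by C0 + `RealisedBy` + a zero-locus presentation + `TopChernFourLocalisation` (v4 §9: `cl Z(s) = c₄`), and testable
  EXACTLY by the `K`-action (shape polynomial) plus ONE linear identity in `χ_{4,4}`. * C5 ALIVE: `μ ≠ 0 ↔ Z·Z ≠ q² h⁸` under
  `WeilAnisotropic` (weaker input than v12's HR-positivity + orientation + `h⁸ ≠ 0`). * C7: every anchor statement is uniform in the
  stub's binders `(e, a)` and `w` — no compatibility with the frame, no hyperbolicity used. * C8 (`d = 1`): §16.1–§16.3 hold for every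
  `d ≥ 1`; disc-one enters nowhere (unchanged: per design vacuous in the types).

House rules kept: no `sorry` ∕ `axiom` ∕ `instance` ∕ `notation` ∕ `macro` ∕ attribute removal ∕ `native_decide` ∕
`allowUnsafeReducibility`; `noncomputable section` closed by the final `end`; cite tags only to keys of the family
(`vanGeemen1994HodgeAV`, `VoisinHodgeI2002`, `HatcherAT2002`, `Thomas2005Nodes`). `lean check`: rc 0, 0 errors, 0 warnings, 0 sorries;
`#print axioms` of the main theorems ⊆ {propext, Classical.choice, Quot.sound}.
-/

noncomputable section

set_option linter.dupNamespace false

open CategoryTheory AlgebraicGeometry Polynomial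
open Literature.AlgebraicGeometry Literature.AlgebraicGeometry.Motives Literature.AlgebraicGeometry.HodgeTheory
open Literature.AlgebraicTopology.SingularHomology

namespace Summit.HodgeConjecture.HodgeConjecture.Cruxes.BlochSeedDiscOne.SeedChecker.Primitive

open Summit.HodgeConjecture.HodgeConjecture.Cruxes.BlochSeedDiscOne.Anchor
open Summit.Ventures.HSemireg Summit.Ventures.HSemireg.Pad4Tower

/-! ## §16.0 The bidegree characters `χ^d_{a,b}(x, y) = (x + iy√d)ᵃ (x − iy√d)ᵇ` -/

section Characters

/-- **the `K`-character of bidegree `(a, b)`**: `χ^d_{a,b}(x, y) = (x + iy√d)ᵃ·(x − iy√d)ᵇ`, the scalar by which the test pull-back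
`(x·𝟙 + y·φ)^*` acts on the summand `⋀ᵃV₊ ⊗ ⋀ᵇV₋ ⊆ H^{a+b}(A(ℂ); ℂ)` (`φ ≫ φ = -d`), spelled LITERALLY as the summand of the tree's
`iSup_pullbackEigenclasses_weilCharacter_eq_top` (v12's `bideg d a b` by `rfl`; v12 is not importable on the current farm snapshot, so the
character is re-spelled here, in a fresh namespace). [cite: vanGeemen1994HodgeAV, 4.8–4.9] -/
def chi (d a b : ℕ) : ℕ → ℕ → ℂ := fun x y =>
  ((x : ℂ) + (y : ℂ) * Complex.I * (Real.sqrt d : ℂ)) ^ a * ((x : ℂ) - (y : ℂ) * Complex.I * (Real.sqrt d : ℂ)) ^ b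

theorem chi_apply (d a b x y : ℕ) : chi d a b x y =
    ((x : ℂ) + (y : ℂ) * Complex.I * (Real.sqrt d : ℂ)) ^ a * ((x : ℂ) - (y : ℂ) * Complex.I * (Real.sqrt d : ℂ)) ^ b :=
  rfl

/-- characters multiply by adding bidegrees. -/
theorem chi_mul (d a b a' b' x y : ℕ) : chi d a b x y * chi d a' b' x y = chi d (a + a') (b + b') x y := by
  simp only [chi_apply, pow_add]
  ring

variable {A : AbelianVariety ℂ} {φ : A ⟶ A} {d : ℕ}

/-- **the tree's character decomposition `Hᵏ = Σ_{a+b=k, a,b ≤ dim A} χ_{a,b}`, in the `chi` spelling** (definitionally the tree's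
`iSup_pullbackEigenclasses_weilCharacter_eq_top`). [cite: vanGeemen1994HodgeAV, 4.9 and proof of Thm. 6.12] -/
theorem iSup_chi_eq_top (hd : 0 < d) (hφ : φ ≫ φ = -(d • 𝟙 A)) (k : ℕ) :
    ⨆ (a : ℕ) (b : ℕ) (_ : a + b = k) (_ : a ≤ A.dim) (_ : b ≤ A.dim), pullbackEigenclasses A φ k (chi d a b) = ⊤ :=
  iSup_pullbackEigenclasses_weilCharacter_eq_top hd hφ k

/-- `E₊ ⊆ χ_{2n,0}` (the same subspace, literal respelling). -/
theorem mem_chi_of_mem_weilClassesPlus {n : ℕ} {c : complexBetti A.X (2 * n)} (hc : c ∈ weilClassesPlus A φ n d) :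
    c ∈ pullbackEigenclasses A φ (2 * n) (chi d (2 * n) 0) := by
  rw [mem_pullbackEigenclasses_iff]
  intro x y
  rw [(mem_weilClassesPlus_iff.mp hc) x y, chi_apply, pow_zero, mul_one]

/-- `E₋ ⊆ χ_{0,2n}` (the same subspace, literal respelling). -/
theorem mem_chi_of_mem_weilClassesMinus {n : ℕ} {c : complexBetti A.X (2 * n)} (hc : c ∈ weilClassesMinus A φ n d) :
    c ∈ pullbackEigenclasses A φ (2 * n) (chi d 0 (2 * n)) := by
  rw [mem_pullbackEigenclasses_iff]
  intro x y
  rw [(mem_weilClassesMinus_iff.mp hc) x y, chi_apply, pow_zero, one_mul]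

/-- cup products of eigenclasses of bidegrees `(a, b)`, `(a', b')` are eigenclasses of bidegree `(a + a', b + b')`
(the tree's `cupProduct_mem_pullbackEigenclasses`, respelled). [cite: HatcherAT2002, §3.2 Prop. 3.10] -/
theorem cupProduct_mem_chi {k l m : ℕ} (h : k + l = m) {a b a' b' : ℕ} {u : complexBetti A.X k} {v : complexBetti A.X l}
    (hu : u ∈ pullbackEigenclasses A φ k (chi d a b)) (hv : v ∈ pullbackEigenclasses A φ l (chi d a' b')) :
    cupProduct h u v ∈ pullbackEigenclasses A φ m (chi d (a + a') (b + b')) := by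
  have h' := cupProduct_mem_pullbackEigenclasses h hu hv
  have e : (fun x y => chi d a b x y * chi d a' b' x y) = chi d (a + a') (b + b') := by
    funext x y
    exact chi_mul d a b a' b' x y
  rw [e] at h'
  exact h'

/-- powers of a balanced degree-`2` class: `h ∈ χ_{1,1} ⟹ hʲ ∈ χ_{j,j}`. -/
theorem cupPowTwo_mem_chi {h : complexBetti A.X 2} (hh : h ∈ pullbackEigenclasses A φ 2 (chi d 1 1)) (j : ℕ) :
    cupPowTwo h j ∈ pullbackEigenclasses A φ (2 * j) (chi d j j) := by
  induction j with
  | zero =>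
    rw [mem_pullbackEigenclasses_iff]
    intro x y
    rw [cupPowTwo_zero, chi_apply, pow_zero, pow_zero, one_mul, one_smul]
    exact singularCohomology.map_one _
  | succ j ih =>
    rw [cupPowTwo_succ]
    exact cupProduct_mem_chi (two_mul_add_two j) ih hh

end Characters

/-! ## §16.1 Off-box vanishing in every degree: `χ_{a,b} = 0` in `Hᵏ` whenever `a > dim A` or `b > dim A` -/

section OffBox

variable {A : AbelianVariety ℂ} {φ : A ⟶ A} {d : ℕ}

/-- a polynomial `p` in an operator acts on a vector of the `μ`-eigenspace (possibly `0`) by the scalar `p(μ)`. [folklore] -/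
private theorem aeval_apply_of_mem_eigenspace' {V : Type*} [AddCommGroup V] [Module ℂ V] {f : Module.End ℂ V} {μ : ℂ} {v : V}
    (hv : v ∈ f.eigenspace μ) (p : ℂ[X]) : aeval f p v = p.eval μ • v := by
  by_cases h0 : v = 0
  · rw [h0, map_zero, smul_zero]
  · exact Module.End.aeval_apply_of_hasEigenvector ⟨hv, h0⟩

/-- if `P(f)` vanishes identically and `P(μ) ≠ 0`, the `μ`-eigenspace of `f` is zero. [folklore] -/
private theorem eq_zero_of_aeval_eq_zero {V : Type*} [AddCommGroup V] [Module ℂ V] {f : Module.End ℂ V} {P : ℂ[X]}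
    (hP : ∀ v : V, aeval f P v = 0) {μ : ℂ} (hμ : P.eval μ ≠ 0) {v : V} (hv : v ∈ f.eigenspace μ) : v = 0 := by
  have h := hP v
  rw [aeval_apply_of_mem_eigenspace' hv] at h
  exact (smul_eq_zero.mp h).resolve_left hμ

/-- `x + i√d ≠ 0 ≠ x − i√d` (non-zero imaginary part). -/
private theorem base_ne_zero (hd : 0 < d) (x : ℕ) :
    (x : ℂ) + ((1 : ℕ) : ℂ) * Complex.I * (Real.sqrt d : ℂ) ≠ 0 ∧
      (x : ℂ) - ((1 : ℕ) : ℂ) * Complex.I * (Real.sqrt d : ℂ) ≠ 0 := by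
  have hsq : (Real.sqrt d : ℝ) ≠ 0 := (Real.sqrt_pos.mpr (by exact_mod_cast hd)).ne'
  have him : (((1 : ℕ) : ℂ) * Complex.I * (Real.sqrt d : ℂ)).im = Real.sqrt d := by
    simp [Complex.mul_im]
  constructor
  · intro h
    have h' := congrArg Complex.im h
    rw [Complex.add_im, him, Complex.natCast_im, zero_add, Complex.zero_im] at h'
    exact hsq h'
  · intro h
    have h' := congrArg Complex.im h
    rw [Complex.sub_im, him, Complex.natCast_im, zero_sub, Complex.zero_im, neg_eq_zero] at h'
    exact hsq h'

/-- **one test isogeny `x₀·𝟙 + φ` separates `uᵐ` from `ūᵐ` for all `1 ≤ m ≤ k` at once** (`u = x₀ + i√d`; from the tree's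
`exists_pos_nat_separating_weilCharacters hd (k + 1)`: `uᵐ ū^{k+1−m} ≠ ū^{k+1}`). -/
theorem exists_pos_nat_pow_ne_conj_pow (hd : 0 < d) (k : ℕ) :
    ∃ x₀ : ℕ, 0 < x₀ ∧ ∀ m : ℕ, 0 < m → m ≤ k →
      ((x₀ : ℂ) + ((1 : ℕ) : ℂ) * Complex.I * (Real.sqrt d : ℂ)) ^ m ≠
        ((x₀ : ℂ) - ((1 : ℕ) : ℂ) * Complex.I * (Real.sqrt d : ℂ)) ^ m := by
  obtain ⟨x₀, hx₀, hsep⟩ := exists_pos_nat_separating_weilCharacters hd (k + 1)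
  refine ⟨x₀, hx₀, fun m hm hmk e => ?_⟩
  apply (hsep m (k + 1 - m) (by omega) hm (by omega)).2
  rw [e, ← pow_add, show m + (k + 1 - m) = k + 1 by omega]

/-- exponent algebra: distinct bidegrees of the same total degree have distinct characters at a test isogeny with `uᵐ ≠ ūᵐ`
(`1 ≤ m ≤ k`). -/
private theorem pow_mul_pow_ne_of_ne {u w : ℂ} (hu : u ≠ 0) (hw : w ≠ 0) {k : ℕ}
    (hsep : ∀ m : ℕ, 0 < m → m ≤ k → u ^ m ≠ w ^ m) {a b a' b' : ℕ} (hab : a + b = k) (hab' : a' + b' = k)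
    (hne : a ≠ a') : u ^ a * w ^ b ≠ u ^ a' * w ^ b' := by
  intro e
  rcases Nat.lt_or_gt_of_ne hne with hlt | hlt
  · obtain ⟨m, rfl⟩ := Nat.exists_eq_add_of_lt hlt
    have hb : b = b' + (m + 1) := by omega
    subst hb
    apply hsep (m + 1) (Nat.succ_pos m) (by omega)
    have hne0 : u ^ a * w ^ b' ≠ 0 := mul_ne_zero (pow_ne_zero _ hu) (pow_ne_zero _ hw)
    have e' : u ^ a * w ^ b' * w ^ (m + 1) = u ^ a * w ^ b' * u ^ (m + 1) := by
      calc u ^ a * w ^ b' * w ^ (m + 1) = u ^ a * w ^ (b' + (m + 1)) := by ring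
        _ = u ^ (a + m + 1) * w ^ b' := e
        _ = u ^ a * w ^ b' * u ^ (m + 1) := by ring
    exact (mul_left_cancel₀ hne0 e').symm
  · obtain ⟨m, rfl⟩ := Nat.exists_eq_add_of_lt hlt
    have hb : b' = b + (m + 1) := by omega
    subst hb
    apply hsep (m + 1) (Nat.succ_pos m) (by omega)
    have hne0 : u ^ a' * w ^ b ≠ 0 := mul_ne_zero (pow_ne_zero _ hu) (pow_ne_zero _ hw)
    have e' : u ^ a' * w ^ b * u ^ (m + 1) = u ^ a' * w ^ b * w ^ (m + 1) := by
      calc u ^ a' * w ^ b * u ^ (m + 1) = u ^ (a' + m + 1) * w ^ b := by ring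
        _ = u ^ a' * w ^ (b + (m + 1)) := e
        _ = u ^ a' * w ^ b * w ^ (m + 1) := by ring
    exact mul_left_cancel₀ hne0 e'

/-- **OFF-BOX VANISHING.** On a complex abelian variety `A` with `φ ≫ φ = -d`, `d ≥ 1`: an eigenclass `c ∈ Hᵏ(A(ℂ); ℂ)` of the
character `χ_{a,b}`, `a + b = k`, with **`a > dim A` or `b > dim A`, is zero** — `⋀ᵃV₊ ⊗ ⋀ᵇV₋ = 0` since `dim V± = dim A`. Carrier proof:
`Hᵏ = Σ_{a'+b'=k, a',b' ≤ g} χ_{a',b'}` (the tree's decomposition); one test isogeny `T = (x₀·𝟙 + φ)^*` with `uᵐ ≠ ūᵐ` for `1 ≤ m ≤ k`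
gives the admissible summands `T`-eigenvalues all different from `χ_{a,b}(x₀, 1)`; the polynomial `P = ∏_{adm}(X − χ_{a',b'}(x₀,1))`
satisfies `P(T) = 0` on `Hᵏ` and `P(T)c = P(χ_{a,b}(x₀,1))·c` with `P(χ_{a,b}(x₀,1)) ≠ 0`. [cite: vanGeemen1994HodgeAV, 4.9 and proof of Thm. 6.12] -/
theorem eq_zero_of_mem_chi_offBox (hd : 0 < d) (hφ : φ ≫ φ = -(d • 𝟙 A)) {k a b : ℕ} (hab : a + b = k)
    (hoff : A.dim < a ∨ A.dim < b) {c : complexBetti A.X k} (hc : c ∈ pullbackEigenclasses A φ k (chi d a b)) : c = 0 := by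
  classical
  obtain ⟨x₀, -, hsep⟩ := exists_pos_nat_pow_ne_conj_pow hd k
  obtain ⟨hu, hw⟩ := base_ne_zero hd x₀
  -- the admissible bidegrees of total degree `k` and the annihilating polynomial of the test pull-back
  let S : Finset (ℕ × ℕ) := (Finset.range (k + 1) ×ˢ Finset.range (k + 1)).filter
    fun q => q.1 + q.2 = k ∧ q.1 ≤ A.dim ∧ q.2 ≤ A.dim
  let P : ℂ[X] := ∏ q ∈ S, (X - C (chi d q.1 q.2 x₀ 1))
  -- (1) `P(T)` kills every admissible summand, hence all of `Hᵏ`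
  have hkill : ∀ v : complexBetti A.X k, aeval (complexBetti.map (x₀ • 𝟙 A + (1 : ℕ) • φ).hom.hom.hom k).hom P v = 0 := by
    intro v
    have hv : v ∈ ⨆ (a : ℕ) (b : ℕ) (_ : a + b = k) (_ : a ≤ A.dim) (_ : b ≤ A.dim),
        pullbackEigenclasses A φ k (chi d a b) := by
      rw [iSup_chi_eq_top hd hφ k]
      trivial
    let M : complexBetti A.X k → Prop := fun v =>
      aeval (complexBetti.map (x₀ • 𝟙 A + (1 : ℕ) • φ).hom.hom.hom k).hom P v = 0
    have hzero : M 0 := by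
      show aeval (complexBetti.map (x₀ • 𝟙 A + (1 : ℕ) • φ).hom.hom.hom k).hom P 0 = 0
      exact map_zero _
    have hadd : ∀ u v : complexBetti A.X k, M u → M v → M (u + v) := by
      intro u v hu' hv'
      show aeval (complexBetti.map (x₀ • 𝟙 A + (1 : ℕ) • φ).hom.hom.hom k).hom P (u + v) = 0
      rw [map_add, hu', hv', add_zero]
    refine Submodule.iSup_induction _ (motive := M) hv (fun a' v hv => ?_) hzero hadd
    refine Submodule.iSup_induction _ (motive := M) hv (fun b' v hv => ?_) hzero hadd
    refine Submodule.iSup_induction _ (motive := M) hv (fun hab' v hv => ?_) hzero hadd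
    refine Submodule.iSup_induction _ (motive := M) hv (fun ha' v hv => ?_) hzero hadd
    refine Submodule.iSup_induction _ (motive := M) hv (fun hb' v hv => ?_) hzero hadd
    have hv' := pullbackEigenclasses_le_eigenspace φ k (chi d a' b') x₀ 1 hv
    have hq : (a', b') ∈ S :=
      Finset.mem_filter.mpr ⟨Finset.mem_product.mpr ⟨Finset.mem_range.mpr (by omega), Finset.mem_range.mpr (by omega)⟩,
        hab', ha', hb'⟩
    have hfac : eval (chi d a' b' x₀ 1) (X - C (chi d (a', b').1 (a', b').2 x₀ 1)) = 0 := by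
      rw [eval_sub, eval_X, eval_C, sub_self]
    show aeval (complexBetti.map (x₀ • 𝟙 A + (1 : ℕ) • φ).hom.hom.hom k).hom P v = 0
    rw [aeval_apply_of_mem_eigenspace' hv' P, Polynomial.eval_prod, Finset.prod_eq_zero hq hfac, zero_smul]
  -- (2) `P` does not vanish at the off-box character
  have hval : P.eval (chi d a b x₀ 1) ≠ 0 := by
    rw [Polynomial.eval_prod, Finset.prod_ne_zero_iff]
    intro q hq
    obtain ⟨-, hq₁, hq₂, hq₃⟩ := Finset.mem_filter.mp hq
    rw [eval_sub, eval_X, eval_C, sub_ne_zero, chi_apply, chi_apply]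
    have hne : a ≠ q.1 := by
      rcases hoff with h | h <;> omega
    exact pow_mul_pow_ne_of_ne hu hw hsep hab hq₁ hne
  -- (3) `c` is a `T`-eigenvector for that character
  exact eq_zero_of_aeval_eq_zero hkill hval (pullbackEigenclasses_le_eigenspace φ k (chi d a b) x₀ 1 hc)

/-- the whole off-box eigenclass space is `⊥`. -/
theorem chi_offBox_eq_bot (hd : 0 < d) (hφ : φ ≫ φ = -(d • 𝟙 A)) {k a b : ℕ} (hab : a + b = k)
    (hoff : A.dim < a ∨ A.dim < b) : pullbackEigenclasses A φ k (chi d a b) = ⊥ :=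
  (Submodule.eq_bot_iff _).mpr fun _ hc => eq_zero_of_mem_chi_offBox hd hφ hab hoff hc

end OffBox

/-! ## §16.2 The Weil plane is killed by every mixed character, in every degree -/

section WeilMixed

variable {A : AbelianVariety ℂ} {φ : A ⟶ A} {d : ℕ}

/-- **`W ∪ χ_{a,b} = 0` in EVERY degree.** On an abelian variety of dimension `2n` with `φ ≫ φ = -d` (`d ≥ 1`): for a Weil class
`w ∈ W = E₊ ⊔ E₋ ⊆ H²ⁿ` and `v ∈ χ_{a,b} ⊆ Hᵐ` with `a, b ≥ 1`: **`w ∪ v = 0` in `H^{2n+m}`** — `E₊ ∪ χ_{a,b} ⊆ χ_{2n+a,b}`,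
`E₋ ∪ χ_{a,b} ⊆ χ_{a,2n+b}`, both off-box (`dim V± = 2n`). This is the cohomological form of «the Weil classes pair to zero with every
product involving both `V₊` and `V₋`», in particular with every monomial in `K`-balanced divisor classes. [cite: vanGeemen1994HodgeAV, 4.9, Lemma 5.2 and 6.10] -/
theorem weil_cupProduct_eq_zero_of_mem_chi (hd : 0 < d) (hφ : φ ≫ φ = -(d • 𝟙 A)) {n : ℕ} (hA : A.dim = 2 * n)
    {m k : ℕ} (hdeg : 2 * n + m = k) {a b : ℕ} (hab : a + b = m) (ha : 0 < a) (hb : 0 < b)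
    {w : complexBetti A.X (2 * n)} (hw : w ∈ weilClassesOf A φ n d) {v : complexBetti A.X m}
    (hv : v ∈ pullbackEigenclasses A φ m (chi d a b)) : cupProduct hdeg w v = 0 := by
  obtain ⟨w₁, hw₁, w₂, hw₂, rfl⟩ := Submodule.mem_sup.mp hw
  have p₁ : cupProduct hdeg w₁ v ∈ pullbackEigenclasses A φ k (chi d (2 * n + a) (0 + b)) :=
    cupProduct_mem_chi hdeg (mem_chi_of_mem_weilClassesPlus hw₁) hv
  have p₂ : cupProduct hdeg w₂ v ∈ pullbackEigenclasses A φ k (chi d (0 + a) (2 * n + b)) :=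
    cupProduct_mem_chi hdeg (mem_chi_of_mem_weilClassesMinus hw₂) hv
  rw [map_add, LinearMap.add_apply, eq_zero_of_mem_chi_offBox hd hφ (by omega) (Or.inl (by omega)) p₁,
    eq_zero_of_mem_chi_offBox hd hφ (by omega) (Or.inr (by omega)) p₂, add_zero]

/-- **`χ_{a,b} ∪ W = 0` in every degree** (the mixed class on the left). -/
theorem cupProduct_weil_eq_zero_of_mem_chi (hd : 0 < d) (hφ : φ ≫ φ = -(d • 𝟙 A)) {n : ℕ} (hA : A.dim = 2 * n)
    {m k : ℕ} (hdeg : m + 2 * n = k) {a b : ℕ} (hab : a + b = m) (ha : 0 < a) (hb : 0 < b)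
    {v : complexBetti A.X m} (hv : v ∈ pullbackEigenclasses A φ m (chi d a b)) {w : complexBetti A.X (2 * n)}
    (hw : w ∈ weilClassesOf A φ n d) : cupProduct hdeg v w = 0 := by
  obtain ⟨w₁, hw₁, w₂, hw₂, rfl⟩ := Submodule.mem_sup.mp hw
  have p₁ : cupProduct hdeg v w₁ ∈ pullbackEigenclasses A φ k (chi d (a + 2 * n) (b + 0)) :=
    cupProduct_mem_chi hdeg hv (mem_chi_of_mem_weilClassesPlus hw₁)
  have p₂ : cupProduct hdeg v w₂ ∈ pullbackEigenclasses A φ k (chi d (a + 0) (b + 2 * n)) :=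
    cupProduct_mem_chi hdeg hv (mem_chi_of_mem_weilClassesMinus hw₂)
  rw [map_add, eq_zero_of_mem_chi_offBox hd hφ (by omega) (Or.inl (by omega)) p₁,
    eq_zero_of_mem_chi_offBox hd hφ (by omega) (Or.inr (by omega)) p₂, add_zero]

/-- **`W ∪ (mixed span) = 0` in every degree**: `w ∪ v = 0` for `v` in the span `Σ_{a+b=m, a,b ≥ 1} χ_{a,b} ⊆ Hᵐ` of the mixed summands. -/
theorem weil_cupProduct_eq_zero_of_mem_mixedSpan (hd : 0 < d) (hφ : φ ≫ φ = -(d • 𝟙 A)) {n : ℕ} (hA : A.dim = 2 * n)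
    {m k : ℕ} (hdeg : 2 * n + m = k) {w : complexBetti A.X (2 * n)} (hw : w ∈ weilClassesOf A φ n d) {v : complexBetti A.X m}
    (hv : v ∈ ⨆ (a : ℕ) (b : ℕ) (_ : a + b = m) (_ : 0 < a) (_ : 0 < b), pullbackEigenclasses A φ m (chi d a b)) :
    cupProduct hdeg w v = 0 := by
  let M : complexBetti A.X m → Prop := fun v => cupProduct hdeg w v = 0
  have hzero : M 0 := by
    show cupProduct hdeg w 0 = 0
    exact map_zero _
  have hadd : ∀ u v : complexBetti A.X m, M u → M v → M (u + v) := by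
    intro u v hu hv
    show cupProduct hdeg w (u + v) = 0
    rw [map_add, hu, hv, add_zero]
  refine Submodule.iSup_induction _ (motive := M) hv (fun a c hc => ?_) hzero hadd
  refine Submodule.iSup_induction _ (motive := M) hc (fun b c hc => ?_) hzero hadd
  refine Submodule.iSup_induction _ (motive := M) hc (fun hab c hc => ?_) hzero hadd
  refine Submodule.iSup_induction _ (motive := M) hc (fun ha c hc => ?_) hzero hadd
  refine Submodule.iSup_induction _ (motive := M) hc (fun hb c hc => ?_) hzero hadd
  exact weil_cupProduct_eq_zero_of_mem_chi hd hφ hA hdeg hab ha hb hw hc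

/-- **a NON-extreme character meets the Weil plane trivially**: a class `x ∈ χ_{a,b} ⊆ H²ⁿ`, `a + b = 2n`, `0 < a`, `0 < b`, which is
also a Weil class (`x ∈ E₊ ⊔ E₋ = χ_{2n,0} ⊔ χ_{0,2n}`) is `0` — distinct characters of ONE test isogeny: the quadratic
`(X − χ_{2n,0}(x₀,1))(X − χ_{0,2n}(x₀,1))` in `(x₀·𝟙 + φ)^*` kills `E₊ ⊔ E₋` and acts on `x` by a non-zero scalar. (This is what makes the
design coordinate `μ` of a shaped class WELL DEFINED, §16.5 `ShapeAt.coords_unique`.) [cite: vanGeemen1994HodgeAV, proof of Thm. 6.12] -/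
theorem eq_zero_of_mem_chi_of_mem_weilClassesOf (hd : 0 < d) {n a b : ℕ} (hab : a + b = 2 * n) (ha : 0 < a) (hb : 0 < b)
    {x : complexBetti A.X (2 * n)} (hx : x ∈ pullbackEigenclasses A φ (2 * n) (chi d a b))
    (hxw : x ∈ weilClassesOf A φ n d) : x = 0 := by
  obtain ⟨x₀, -, hsep⟩ := exists_pos_nat_pow_ne_conj_pow hd (2 * n)
  obtain ⟨hu, hw⟩ := base_ne_zero hd x₀
  obtain ⟨w₁, hw₁, w₂, hw₂, hsum⟩ := Submodule.mem_sup.mp hxw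
  have e₁ := aeval_apply_of_mem_eigenspace'
    (pullbackEigenclasses_le_eigenspace φ (2 * n) (chi d (2 * n) 0) x₀ 1 (mem_chi_of_mem_weilClassesPlus hw₁))
    ((X - C (chi d (2 * n) 0 x₀ 1)) * (X - C (chi d 0 (2 * n) x₀ 1)))
  have e₂ := aeval_apply_of_mem_eigenspace'
    (pullbackEigenclasses_le_eigenspace φ (2 * n) (chi d 0 (2 * n)) x₀ 1 (mem_chi_of_mem_weilClassesMinus hw₂))
    ((X - C (chi d (2 * n) 0 x₀ 1)) * (X - C (chi d 0 (2 * n) x₀ 1)))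
  have ex := aeval_apply_of_mem_eigenspace' (pullbackEigenclasses_le_eigenspace φ (2 * n) (chi d a b) x₀ 1 hx)
    ((X - C (chi d (2 * n) 0 x₀ 1)) * (X - C (chi d 0 (2 * n) x₀ 1)))
  have hkill : aeval (complexBetti.map (x₀ • 𝟙 A + (1 : ℕ) • φ).hom.hom.hom (2 * n)).hom
      ((X - C (chi d (2 * n) 0 x₀ 1)) * (X - C (chi d 0 (2 * n) x₀ 1))) x = 0 := by
    rw [← hsum, map_add, e₁, e₂]
    simp only [eval_mul, eval_sub, eval_X, eval_C, sub_self, zero_mul, mul_zero, zero_smul, add_zero]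
  have hval : ((X - C (chi d (2 * n) 0 x₀ 1)) * (X - C (chi d 0 (2 * n) x₀ 1))).eval (chi d a b x₀ 1) ≠ 0 := by
    rw [eval_mul, eval_sub, eval_X, eval_C, eval_sub, eval_X, eval_C]
    refine mul_ne_zero (sub_ne_zero.mpr ?_) (sub_ne_zero.mpr ?_)
    · rw [chi_apply, chi_apply]
      exact pow_mul_pow_ne_of_ne hu hw hsep hab (show 2 * n + 0 = 2 * n by omega) (by omega)
    · rw [chi_apply, chi_apply]
      exact pow_mul_pow_ne_of_ne hu hw hsep hab (show 0 + 2 * n = 2 * n by omega) (by omega)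
  rw [ex] at hkill
  exact (smul_eq_zero.mp hkill).resolve_left hval

end WeilMixed

/-! ## §16.3 `h`-primitivity of the Weil plane: `w ∪ h = 0`, `w ∪ hʲ = 0` for every `K`-balanced `h` -/

section Primitive

variable {A : AbelianVariety ℂ} {φ : A ⟶ A} {d : ℕ}

/-- **`d·c + φ^*c ∈ χ_{1,1}` for every `c ∈ H²(A(ℂ); ℂ)`** (`φ ≫ φ = -d`, `d ≥ 1`): in `H² = χ_{2,0} ⊕ χ_{1,1} ⊕ χ_{0,2}` the pull-back
`φ^* = (0·𝟙 + 1·φ)^*` acts by `−d, d, −d`, so the `K`-symmetrisation kills the outer summands and doubles the middle one (v12's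
`natCast_smul_add_map_mem_bideg`, v8's `…_mem_balanced`; neither importable on the current snapshot, hence re-derived).
[cite: vanGeemen1994HodgeAV, 4.9 and proof of Lemma 5.2 (1)] -/
theorem natCast_smul_add_map_mem_chi (hd : 0 < d) (hφ : φ ≫ φ = -(d • 𝟙 A)) (c : complexBetti A.X 2) :
    (d : ℂ) • c + complexBetti.map φ.hom.hom.hom 2 c ∈ pullbackEigenclasses A φ 2 (chi d 1 1) := by
  have hc : c ∈ ⨆ (a : ℕ) (b : ℕ) (_ : a + b = 2) (_ : a ≤ A.dim) (_ : b ≤ A.dim), pullbackEigenclasses A φ 2 (chi d a b) := by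
    rw [iSup_chi_eq_top hd hφ 2]
    trivial
  let S : complexBetti A.X 2 → Prop := fun c =>
    (d : ℂ) • c + complexBetti.map φ.hom.hom.hom 2 c ∈ pullbackEigenclasses A φ 2 (chi d 1 1)
  have hzero : S 0 := by
    show (d : ℂ) • (0 : complexBetti A.X 2) + complexBetti.map φ.hom.hom.hom 2 0 ∈ _
    rw [smul_zero, map_zero, add_zero]
    exact Submodule.zero_mem _
  have hadd : ∀ u v : complexBetti A.X 2, S u → S v → S (u + v) := by
    intro u v hu hv
    show (d : ℂ) • (u + v) + complexBetti.map φ.hom.hom.hom 2 (u + v) ∈ _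
    rw [smul_add, map_add, add_add_add_comm]
    exact Submodule.add_mem _ hu hv
  refine Submodule.iSup_induction _ (motive := S) hc (fun a c hc => ?_) hzero hadd
  refine Submodule.iSup_induction _ (motive := S) hc (fun b c hc => ?_) hzero hadd
  refine Submodule.iSup_induction _ (motive := S) hc (fun hab c hc => ?_) hzero hadd
  refine Submodule.iSup_induction _ (motive := S) hc (fun _ c hc => ?_) hzero hadd
  refine Submodule.iSup_induction _ (motive := S) hc (fun _ c hc => ?_) hzero hadd
  -- `hc : c ∈ χ_{a,b}`, `a + b = 2`: the action of `φ^* = (0·𝟙 + 1·φ)^*` on `c`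
  have hφc : complexBetti.map φ.hom.hom.hom 2 c =
      ((Complex.I * (Real.sqrt d : ℂ)) ^ a * (-(Complex.I * (Real.sqrt d : ℂ))) ^ b) • c := by
    have h01 := (mem_pullbackEigenclasses_iff.mp hc) 0 1
    have e : ((0 : ℕ) • 𝟙 A + (1 : ℕ) • φ : A ⟶ A) = φ := by simp
    rw [e] at h01
    change complexBetti.map φ.hom.hom.hom 2 c = _ at h01
    rw [h01]
    congr 1
    rw [chi_apply]
    push_cast
    ring
  have hsq : (Complex.I * (Real.sqrt d : ℂ)) ^ 2 = -(d : ℂ) := I_mul_sqrt_sq d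
  show (d : ℂ) • c + complexBetti.map φ.hom.hom.hom 2 c ∈ pullbackEigenclasses A φ 2 (chi d 1 1)
  rcases Nat.lt_or_ge a 1 with ha | ha
  · obtain rfl : a = 0 := by omega
    obtain rfl : b = 2 := by omega
    rw [hφc, pow_zero, one_mul, neg_pow, hsq]
    norm_num
  rcases Nat.lt_or_ge a 2 with ha2 | ha2
  · obtain rfl : a = 1 := by omega
    obtain rfl : b = 1 := by omega
    have hc' : c ∈ pullbackEigenclasses A φ 2 (chi d 1 1) := hc
    exact Submodule.add_mem _ (Submodule.smul_mem _ _ hc') (by rw [hφc]; exact Submodule.smul_mem _ _ hc')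
  · obtain rfl : a = 2 := by omega
    obtain rfl : b = 0 := by omega
    rw [hφc, pow_zero, mul_one, hsq]
    norm_num

/-- a `φ`-INVARIANT degree-`2` class (`d = 1`) is balanced: `c + φ^*c = 2c ∈ χ_{1,1}`. -/
theorem mem_chi_of_map_eq_self (hφ : φ ≫ φ = -(1 • 𝟙 A)) {c : complexBetti A.X 2}
    (hc : complexBetti.map φ.hom.hom.hom 2 c = c) : c ∈ pullbackEigenclasses A φ 2 (chi 1 1 1) := by
  have h := natCast_smul_add_map_mem_chi one_pos hφ c
  rw [hc, Nat.cast_one, one_smul, ← two_smul ℂ] at h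
  exact (Submodule.smul_mem_iff _ (two_ne_zero : (2 : ℂ) ≠ 0)).mp h

/-- **THE WEIL PLANE IS `h`-PRIMITIVE: `w ∪ h = 0` in `H^{2n+2}(A(ℂ); ℂ)`** for every Weil class `w ∈ W ⊆ H²ⁿ` of a `2n`-fold with
`φ ≫ φ = -d` and every `K`-balanced `h ∈ χ_{1,1} ⊆ H²` (e.g. `h = d·c + φ^*c`, any `c`; every `φ`-invariant polarisation at `d = 1`).
Van Geemen, Lemma 5.2 (a polarisation of Weil type satisfies `(√−d)^*E = dE`, i.e. `E ∈ χ_{1,1}`) with 6.10 (`W, W̄` are `E`-isotropic)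
gives in one line that the space of Weil classes `⋀^{2n}_K H¹ = ⋀^{2n}W ⊕ ⋀^{2n}W̄` consists of `E`-PRIMITIVE classes for every
`K`-compatible polarisation — on the carrier, `E₊ ∪ h ⊆ χ_{2n+1,1} = 0`, `E₋ ∪ h ⊆ χ_{1,2n+1} = 0`. In middle degree «primitive» MEANS «killed by one more `h`», so this
is the full statement, and it is what makes the Hodge–Riemann form DEFINITE on `W_ℝ` (the sign input of §16.6).
[cite: vanGeemen1994HodgeAV, Lemma 5.2 and 6.10] [cite: VoisinHodgeI2002, Thm. 6.32] -/
theorem weil_cupProduct_h_eq_zero (hd : 0 < d) (hφ : φ ≫ φ = -(d • 𝟙 A)) {n : ℕ} (hA : A.dim = 2 * n) {k : ℕ}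
    (hdeg : 2 * n + 2 = k) {w : complexBetti A.X (2 * n)} (hw : w ∈ weilClassesOf A φ n d) {h : complexBetti A.X 2}
    (hh : h ∈ pullbackEigenclasses A φ 2 (chi d 1 1)) : cupProduct hdeg w h = 0 :=
  weil_cupProduct_eq_zero_of_mem_chi hd hφ hA hdeg (a := 1) (b := 1) rfl one_pos one_pos hw hh

/-- `h ∪ w = 0` in `H^{2n+2}`. -/
theorem h_cupProduct_weil_eq_zero (hd : 0 < d) (hφ : φ ≫ φ = -(d • 𝟙 A)) {n : ℕ} (hA : A.dim = 2 * n) {k : ℕ}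
    (hdeg : 2 + 2 * n = k) {h : complexBetti A.X 2} (hh : h ∈ pullbackEigenclasses A φ 2 (chi d 1 1))
    {w : complexBetti A.X (2 * n)} (hw : w ∈ weilClassesOf A φ n d) : cupProduct hdeg h w = 0 :=
  cupProduct_weil_eq_zero_of_mem_chi hd hφ hA hdeg (a := 1) (b := 1) rfl one_pos one_pos hh hw

/-- **`w ∪ hʲ = 0` in `H^{2n+2j}` for every `j ≥ 1`** (at `j = n`: v12's «the Weil plane is invisible to the `h`-degree»). -/
theorem weil_cupProduct_hPow_eq_zero (hd : 0 < d) (hφ : φ ≫ φ = -(d • 𝟙 A)) {n : ℕ} (hA : A.dim = 2 * n) {j k : ℕ}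
    (hj : 0 < j) (hdeg : 2 * n + 2 * j = k) {w : complexBetti A.X (2 * n)} (hw : w ∈ weilClassesOf A φ n d)
    {h : complexBetti A.X 2} (hh : h ∈ pullbackEigenclasses A φ 2 (chi d 1 1)) : cupProduct hdeg w (cupPowTwo h j) = 0 :=
  weil_cupProduct_eq_zero_of_mem_chi hd hφ hA hdeg (a := j) (b := j) (by ring) hj hj hw (cupPowTwo_mem_chi hh j)

/-- `hʲ ∪ w = 0` for every `j ≥ 1`. -/
theorem hPow_cupProduct_weil_eq_zero (hd : 0 < d) (hφ : φ ≫ φ = -(d • 𝟙 A)) {n : ℕ} (hA : A.dim = 2 * n) {j k : ℕ}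
    (hj : 0 < j) (hdeg : 2 * j + 2 * n = k) {h : complexBetti A.X 2} (hh : h ∈ pullbackEigenclasses A φ 2 (chi d 1 1))
    {w : complexBetti A.X (2 * n)} (hw : w ∈ weilClassesOf A φ n d) : cupProduct hdeg (cupPowTwo h j) w = 0 :=
  cupProduct_weil_eq_zero_of_mem_chi hd hφ hA hdeg (a := j) (b := j) (by ring) hj hj (cupPowTwo_mem_chi hh j) hw

/-- **`w ∪ (d·c + φ^*c) = 0` for EVERY degree-`2` class `c`** — no hypothesis on `c` at all. -/
theorem weil_cupProduct_symmetrised_eq_zero (hd : 0 < d) (hφ : φ ≫ φ = -(d • 𝟙 A)) {n : ℕ} (hA : A.dim = 2 * n) {k : ℕ}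
    (hdeg : 2 * n + 2 = k) {w : complexBetti A.X (2 * n)} (hw : w ∈ weilClassesOf A φ n d) (c : complexBetti A.X 2) :
    cupProduct hdeg w ((d : ℂ) • c + complexBetti.map φ.hom.hom.hom 2 c) = 0 :=
  weil_cupProduct_h_eq_zero hd hφ hA hdeg hw (natCast_smul_add_map_mem_chi hd hφ c)

end Primitive

/-! ## §16.4 On the pad-4 anchor `S⁴`: `w ∪ h_K = 0` in `H¹⁰(S⁴)` for the stub's `h_K = symH ψ e a`, EVERY `(e, a)`; `h_std`; `wOf μ` -/

section Anchor

variable {E₀ : AbelianVariety ℂ} {ψ₀ : E₀ ⟶ E₀}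

/-- degree bookkeeping `H⁸ × H² → H¹⁰`. -/
theorem d41 : 2 * 4 + 2 = 2 * 5 := by norm_num
/-- degree bookkeeping `H² × H⁸ → H¹⁰`. -/
theorem d14 : 2 + 2 * 4 = 2 * 5 := by norm_num
/-- degree bookkeeping `H⁸ × H^{2j} → H^{2(4+j)}`. -/
theorem d4j (j : ℕ) : 2 * 4 + 2 * j = 2 * (4 + j) := by ring
/-- degree bookkeeping `H⁸ × H⁸ → H¹⁶` (v12's `deg448`, renamed to keep the namespaces disjoint). -/
theorem d448 : 2 * 4 + 2 * 4 = 2 * 8 := by norm_num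

/-- **the stub's `h_K = symH ψ e a = 1·e^*a + ψ^*e^*a` is `K`-balanced for EVERY projective embedding `e` and EVERY class `a`** — no
compatibility of `(e, a)` with the frame and no hyperbolicity is needed (C7: uniform in the stub's binders). -/
theorem symH_mem_chi (hψ : ψ₀ ≫ ψ₀ = -(1 • 𝟙 E₀)) (e : ProjectiveEmbedding (pad4Anchor E₀).X)
    (a : complexBetti (projectiveSpace e.n ℂ) 2) :
    symH (pad4Action E₀ ψ₀) e a ∈ pullbackEigenclasses (pad4Anchor E₀) (pad4Action E₀ ψ₀) 2 (chi 1 1 1) :=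
  natCast_smul_add_map_mem_chi one_pos (pad4Action_comp_self hψ) (complexBetti.map e.ι 2 a)

/-- **the frame's `h_std` is `K`-balanced** (`ψ^* h_std = h_std`, v4 `map_pad4Action_hStd`). -/
theorem hStd_mem_chi (hE : E₀.dim = 1) (hψ : ψ₀ ≫ ψ₀ = -(1 • 𝟙 E₀)) (η : complexBetti E₀.X 2) :
    hStd E₀ η ∈ pullbackEigenclasses (pad4Anchor E₀) (pad4Action E₀ ψ₀) 2 (chi 1 1 1) :=
  mem_chi_of_map_eq_self (pad4Action_comp_self hψ) (map_pad4Action_hStd hE hψ)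

/-- **`w ∪ h = 0` in `H¹⁰(S⁴(ℂ); ℂ)` for every Weil class `w` of the anchor and every balanced `h`.** -/
theorem pad4_weil_cupProduct_h_eq_zero (hE : E₀.dim = 1) (hψ : ψ₀ ≫ ψ₀ = -(1 • 𝟙 E₀))
    {w : complexBetti (pad4Anchor E₀).X (2 * 4)} (hw : w ∈ weilClassesOf (pad4Anchor E₀) (pad4Action E₀ ψ₀) 4 1)
    {h : complexBetti (pad4Anchor E₀).X 2} (hh : h ∈ pullbackEigenclasses (pad4Anchor E₀) (pad4Action E₀ ψ₀) 2 (chi 1 1 1)) :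
    cupProduct d41 w h = 0 :=
  weil_cupProduct_h_eq_zero one_pos (pad4Action_comp_self hψ) (pad4Anchor_dim hE) d41 hw hh

/-- `h ∪ w = 0` in `H¹⁰(S⁴)`. -/
theorem pad4_h_cupProduct_weil_eq_zero (hE : E₀.dim = 1) (hψ : ψ₀ ≫ ψ₀ = -(1 • 𝟙 E₀))
    {h : complexBetti (pad4Anchor E₀).X 2} (hh : h ∈ pullbackEigenclasses (pad4Anchor E₀) (pad4Action E₀ ψ₀) 2 (chi 1 1 1))
    {w : complexBetti (pad4Anchor E₀).X (2 * 4)} (hw : w ∈ weilClassesOf (pad4Anchor E₀) (pad4Action E₀ ψ₀) 4 1) :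
    cupProduct d14 h w = 0 :=
  h_cupProduct_weil_eq_zero one_pos (pad4Action_comp_self hψ) (pad4Anchor_dim hE) d14 hh hw

/-- **`w ∪ hʲ = 0` in `H^{2(4+j)}(S⁴)` for every `j ≥ 1`** and every balanced `h`. -/
theorem pad4_weil_cupProduct_hPow_eq_zero (hE : E₀.dim = 1) (hψ : ψ₀ ≫ ψ₀ = -(1 • 𝟙 E₀)) {j k : ℕ} (hj : 0 < j)
    (hdeg : 2 * 4 + 2 * j = k) {w : complexBetti (pad4Anchor E₀).X (2 * 4)}
    (hw : w ∈ weilClassesOf (pad4Anchor E₀) (pad4Action E₀ ψ₀) 4 1) {h : complexBetti (pad4Anchor E₀).X 2}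
    (hh : h ∈ pullbackEigenclasses (pad4Anchor E₀) (pad4Action E₀ ψ₀) 2 (chi 1 1 1)) : cupProduct hdeg w (cupPowTwo h j) = 0 :=
  weil_cupProduct_hPow_eq_zero one_pos (pad4Action_comp_self hψ) (pad4Anchor_dim hE) hj hdeg hw hh

/-- **`w ∪ h_K = 0` in `H¹⁰(S⁴)` for the stub's `h_K = symH ψ e a`, EVERY `(e, a)`, every Weil class `w`** — an unconditional law the
output `(e, a, w)` of `stub_rung_pad4_seedAt` satisfies, whatever the construction. -/
theorem pad4_weil_cupProduct_symH_eq_zero (hE : E₀.dim = 1) (hψ : ψ₀ ≫ ψ₀ = -(1 • 𝟙 E₀))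
    (e : ProjectiveEmbedding (pad4Anchor E₀).X) (a : complexBetti (projectiveSpace e.n ℂ) 2)
    {w : complexBetti (pad4Anchor E₀).X (2 * 4)} (hw : w ∈ weilClassesOf (pad4Anchor E₀) (pad4Action E₀ ψ₀) 4 1) :
    cupProduct d41 w (symH (pad4Action E₀ ψ₀) e a) = 0 :=
  pad4_weil_cupProduct_h_eq_zero hE hψ hw (symH_mem_chi hψ e a)

/-- **`w ∪ h_Kʲ = 0`**, `j ≥ 1`, for the stub's `h_K`, every `(e, a)`. -/
theorem pad4_weil_cupProduct_symHPow_eq_zero (hE : E₀.dim = 1) (hψ : ψ₀ ≫ ψ₀ = -(1 • 𝟙 E₀))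
    (e : ProjectiveEmbedding (pad4Anchor E₀).X) (a : complexBetti (projectiveSpace e.n ℂ) 2) {j k : ℕ} (hj : 0 < j)
    (hdeg : 2 * 4 + 2 * j = k) {w : complexBetti (pad4Anchor E₀).X (2 * 4)}
    (hw : w ∈ weilClassesOf (pad4Anchor E₀) (pad4Action E₀ ψ₀) 4 1) :
    cupProduct hdeg w (cupPowTwo (symH (pad4Action E₀ ψ₀) e a) j) = 0 :=
  pad4_weil_cupProduct_hPow_eq_zero hE hψ hj hdeg hw (symH_mem_chi hψ e a)

/-- **`w ∪ h_std = 0` in `H¹⁰(S⁴)`** for every Weil class `w`. -/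
theorem pad4_weil_cupProduct_hStd_eq_zero (hE : E₀.dim = 1) (hψ : ψ₀ ≫ ψ₀ = -(1 • 𝟙 E₀)) (η : complexBetti E₀.X 2)
    {w : complexBetti (pad4Anchor E₀).X (2 * 4)} (hw : w ∈ weilClassesOf (pad4Anchor E₀) (pad4Action E₀ ψ₀) 4 1) :
    cupProduct d41 w (hStd E₀ η) = 0 :=
  pad4_weil_cupProduct_h_eq_zero hE hψ hw (hStd_mem_chi hE hψ η)

/-- `w ∪ h_stdʲ = 0`, `j ≥ 1`. -/
theorem pad4_weil_cupProduct_hStdPow_eq_zero (hE : E₀.dim = 1) (hψ : ψ₀ ≫ ψ₀ = -(1 • 𝟙 E₀)) (η : complexBetti E₀.X 2)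
    {j k : ℕ} (hj : 0 < j) (hdeg : 2 * 4 + 2 * j = k) {w : complexBetti (pad4Anchor E₀).X (2 * 4)}
    (hw : w ∈ weilClassesOf (pad4Anchor E₀) (pad4Action E₀ ψ₀) 4 1) : cupProduct hdeg w (cupPowTwo (hStd E₀ η) j) = 0 :=
  pad4_weil_cupProduct_hPow_eq_zero hE hψ hj hdeg hw (hStd_mem_chi hE hψ η)

/-- the frame classes `wOf μ = Re μ·r₁ + Im μ·r₂` are `h`-primitive: `wOf μ ∪ h = 0`. -/
theorem pad4_wOf_cupProduct_h_eq_zero (hE : E₀.dim = 1) (hψ : ψ₀ ≫ ψ₀ = -(1 • 𝟙 E₀)) (F : WeilFrame E₀ ψ₀) (μ : GaussianInt)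
    {h : complexBetti (pad4Anchor E₀).X 2} (hh : h ∈ pullbackEigenclasses (pad4Anchor E₀) (pad4Action E₀ ψ₀) 2 (chi 1 1 1)) :
    cupProduct d41 (F.wOf μ) h = 0 :=
  pad4_weil_cupProduct_h_eq_zero hE hψ (F.wOf_mem μ) hh

/-- `wOf μ ∪ hʲ = 0`, `j ≥ 1`. -/
theorem pad4_wOf_cupProduct_hPow_eq_zero (hE : E₀.dim = 1) (hψ : ψ₀ ≫ ψ₀ = -(1 • 𝟙 E₀)) (F : WeilFrame E₀ ψ₀) (μ : GaussianInt)
    {j k : ℕ} (hj : 0 < j) (hdeg : 2 * 4 + 2 * j = k) {h : complexBetti (pad4Anchor E₀).X 2}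
    (hh : h ∈ pullbackEigenclasses (pad4Anchor E₀) (pad4Action E₀ ψ₀) 2 (chi 1 1 1)) :
    cupProduct hdeg (F.wOf μ) (cupPowTwo h j) = 0 :=
  pad4_weil_cupProduct_hPow_eq_zero hE hψ hj hdeg (F.wOf_mem μ) hh

/-- `hʲ ∪ wOf μ = 0`, `j ≥ 1` (the other order, degree spelling `2j + 8`). -/
theorem pad4_hPow_cupProduct_wOf_eq_zero (hE : E₀.dim = 1) (hψ : ψ₀ ≫ ψ₀ = -(1 • 𝟙 E₀)) (F : WeilFrame E₀ ψ₀) (μ : GaussianInt)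
    {j k : ℕ} (hj : 0 < j) (hdeg : 2 * j + 2 * 4 = k) {h : complexBetti (pad4Anchor E₀).X 2}
    (hh : h ∈ pullbackEigenclasses (pad4Anchor E₀) (pad4Action E₀ ψ₀) 2 (chi 1 1 1)) :
    cupProduct hdeg (cupPowTwo h j) (F.wOf μ) = 0 :=
  hPow_cupProduct_weil_eq_zero one_pos (pad4Action_comp_self hψ) (pad4Anchor_dim hE) hj hdeg hh (F.wOf_mem μ)

end Anchor

/-! ## §16.5 The C5 SHAPE, typed: `x ∈ ℚ·h⁴ ⊕ W_K`, its exact Lefschetz and `K`-isotypic shadows, and the blindness of the numbers -/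

section Shape

variable {E₀ : AbelianVariety ℂ} {ψ₀ : E₀ ⟶ E₀}

/-- **THE C5 SHAPE of a class `x ∈ H⁸(S⁴(ℂ); ℂ)`** relative to a Weil frame `F` and a polarisation class `h`: `x` lies on the C5
lattice `ℚ·h⁴ ⊕ W_K` — `x = q·h⁴ + wOf μ` for some `q ∈ ℚ` and `μ ∈ ℤ[i]` (`wOf μ = μ·eeee + μ̄·ēēēē`). This is the predicate the
presentation's `cl(Z)` (lci door: purity makes `classesSupportedOn … Z` the line `ℂ·cl(Z)` for `Z` irreducible of codimension `4`) or
the sheaf door's `ch₄(𝓔)` must satisfy BEFORE the design coordinate `μ` can even be read; it is recorded SEPARATELY from the three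
numbers `Z·Z`, `Z·h⁴`, `h⁸` (critic rider w1), because no finite list of numbers certifies it (`numbers_blind_to_isotropic_primitive`). -/
def ShapeAt (F : WeilFrame E₀ ψ₀) (h : complexBetti (pad4Anchor E₀).X 2) (x : complexBetti (pad4Anchor E₀).X (2 * 4)) : Prop :=
  ∃ (q : ℚ) (μ : GaussianInt), x = ((q : ℚ) : ℂ) • cupPowTwo h 4 + F.wOf μ

/-- **ALIVE**: the shape with a NON-ZERO Weil coordinate — `x = q·h⁴ + wOf μ`, `μ ≠ 0` (the class is «the target Weil ∕ non-divisor
class, not a divisor polynomial»: at the CM anchor every Hodge class is a polynomial in divisors, so «non-divisor» can only mean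
«non-zero `W_K`-component»). The design half of C5 (C0's `μ ≠ 0`) AT THE SEED. -/
def AliveAt (F : WeilFrame E₀ ψ₀) (h : complexBetti (pad4Anchor E₀).X 2) (x : complexBetti (pad4Anchor E₀).X (2 * 4)) : Prop :=
  ∃ (q : ℚ) (μ : GaussianInt), μ ≠ 0 ∧ x = ((q : ℚ) : ℂ) • cupPowTwo h 4 + F.wOf μ

theorem AliveAt.shapeAt {F : WeilFrame E₀ ψ₀} {h : complexBetti (pad4Anchor E₀).X 2} {x : complexBetti (pad4Anchor E₀).X (2 * 4)}
    (hx : AliveAt F h x) : ShapeAt F h x := by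
  obtain ⟨q, μ, -, rfl⟩ := hx
  exact ⟨q, μ, rfl⟩

/-- `wOf 0 = 0`. -/
theorem wOf_zero (F : WeilFrame E₀ ψ₀) : F.wOf 0 = 0 := by
  unfold WeilFrame.wOf
  rw [Zsqrtd.re_zero, Zsqrtd.im_zero, Int.cast_zero, Rat.cast_zero, zero_smul, zero_smul, add_zero]

/-- **the frame map `μ ↦ wOf μ` is injective** (`r₁, r₂` are `ℂ`-independent): the Gaussian integer of a frame class is unique. -/
theorem wOf_injective (F : WeilFrame E₀ ψ₀) : Function.Injective F.wOf := by
  intro μ μ' h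
  have h0 : (((μ.re : ℚ) : ℂ) - ((μ'.re : ℚ) : ℂ)) • F.rOne + (((μ.im : ℚ) : ℂ) - ((μ'.im : ℚ) : ℂ)) • F.rTwo = 0 := by
    have h' : F.wOf μ - F.wOf μ' = 0 := sub_eq_zero.mpr h
    unfold WeilFrame.wOf at h'
    rw [← h', sub_smul, sub_smul]
    abel
  obtain ⟨hre, him⟩ := F.indep _ _ h0
  have hre' : μ.re = μ'.re := by exact_mod_cast sub_eq_zero.mp hre
  have him' : μ.im = μ'.im := by exact_mod_cast sub_eq_zero.mp him
  exact Zsqrtd.ext hre' him'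

/-- the class asserted by v4's `ClassCheck K μ i q` (supported on the seed) is ALIVE in this sense, with the SAME `(q, μ)` —
`ClassCheck` = `AliveAt`-witness `(q, μ)` + support on `Z`; so C5 at the seed splits as SHAPE ∧ (`μ ≠ 0`) ∧ SUPPORT. -/
theorem aliveAt_of_classCheck (K : AnchorKit E₀ ψ₀) {μ : GaussianInt} {Z : Scheme.{0}} {i : Z ⟶ (pad4Anchor E₀).X.left} {q : ℚ}
    (hc : ClassCheck K μ i q) :
    AliveAt K.F (symH (pad4Action E₀ ψ₀) K.pol.e K.pol.a)
      (((q : ℚ) : ℂ) • cupPowTwo (symH (pad4Action E₀ ψ₀) K.pol.e K.pol.a) 4 + K.F.wOf μ) :=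
  ⟨q, μ, hc.1, rfl⟩

/-- a shaped class is RATIONAL whenever `h` is (`wOf μ` is rational by the frame). -/
theorem ShapeAt.isRationalClass {F : WeilFrame E₀ ψ₀} {h : complexBetti (pad4Anchor E₀).X 2}
    {x : complexBetti (pad4Anchor E₀).X (2 * 4)} (hx : ShapeAt F h x) (hh : IsRationalClass (cupPowTwo h 4)) :
    IsRationalClass x := by
  obtain ⟨q, μ, rfl⟩ := hx
  exact (hh.smul q).add (F.wOf_rational μ)

/-- `K`-ISOTYPIC SHADOW: **a shaped class lies in `χ_{4,4} ⊔ W`** (for balanced `h`): its components on the `K`-summands `χ_{a,b}`,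
`(a, b) ∉ {(4,4), (8,0), (0,8)}`, vanish. -/
theorem ShapeAt.mem_sup {F : WeilFrame E₀ ψ₀} {h : complexBetti (pad4Anchor E₀).X 2}
    (hh : h ∈ pullbackEigenclasses (pad4Anchor E₀) (pad4Action E₀ ψ₀) 2 (chi 1 1 1)) {x : complexBetti (pad4Anchor E₀).X (2 * 4)}
    (hx : ShapeAt F h x) :
    x ∈ pullbackEigenclasses (pad4Anchor E₀) (pad4Action E₀ ψ₀) (2 * 4) (chi 1 4 4) ⊔
      weilClassesOf (pad4Anchor E₀) (pad4Action E₀ ψ₀) 4 1 := by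
  obtain ⟨q, μ, rfl⟩ := hx
  exact Submodule.add_mem_sup (Submodule.smul_mem _ _ (cupPowTwo_mem_chi hh 4)) (F.wOf_mem μ)

/-- `hᵃ ∪ hᵇ = h^{a+b}`. [cite: HatcherAT2002, §3.2] -/
theorem hPow_cupProduct_hPow (h : complexBetti (pad4Anchor E₀).X 2) {a b m : ℕ} (hm : a + b = m) (hab : 2 * a + 2 * b = 2 * m) :
    cupProduct hab (cupPowTwo h a) (cupPowTwo h b) = cupPowTwo h m :=
  Literature.AlgebraicGeometry.HodgeTheory.cupProduct_cupPowTwo_cupPowTwo h hm hab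

/-- **LEFSCHETZ SHADOW: `x ∪ hʲ = q·h^{4+j}` for every `j ≥ 1`** and every shaped `x = q·h⁴ + wOf μ` (balanced `h`). At `j = 1`:
**`x ∪ h ∈ ℂ·h⁵`** — the `h`-primitive part of `x` is exactly `x − q·h⁴` (a VECTOR identity in `H¹⁰(S⁴)`, `dim H¹⁰ = C(16,10) = 8008`, not a
number); at `j = 4`: v12's `x ∪ h⁴ = q·h⁸`. -/
theorem ShapeAt.cupProduct_hPow (hE : E₀.dim = 1) (hψ : ψ₀ ≫ ψ₀ = -(1 • 𝟙 E₀)) {F : WeilFrame E₀ ψ₀}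
    {h : complexBetti (pad4Anchor E₀).X 2} (hh : h ∈ pullbackEigenclasses (pad4Anchor E₀) (pad4Action E₀ ψ₀) 2 (chi 1 1 1))
    {x : complexBetti (pad4Anchor E₀).X (2 * 4)} {q : ℚ} {μ : GaussianInt}
    (hx : x = ((q : ℚ) : ℂ) • cupPowTwo h 4 + F.wOf μ) {j : ℕ} (hj : 0 < j) :
    cupProduct (d4j j) x (cupPowTwo h j) = ((q : ℚ) : ℂ) • cupPowTwo h (4 + j) := by
  rw [hx, LinearMap.map_add₂, LinearMap.map_smul₂, pad4_wOf_cupProduct_hPow_eq_zero hE hψ F μ hj (d4j j) hh, add_zero,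
    hPow_cupProduct_hPow h rfl (d4j j)]

/-- the case `j = 1`: **`x ∪ h = q·h⁵`**. -/
theorem ShapeAt.cupProduct_h (hE : E₀.dim = 1) (hψ : ψ₀ ≫ ψ₀ = -(1 • 𝟙 E₀)) {F : WeilFrame E₀ ψ₀}
    {h : complexBetti (pad4Anchor E₀).X 2} (hh : h ∈ pullbackEigenclasses (pad4Anchor E₀) (pad4Action E₀ ψ₀) 2 (chi 1 1 1))
    {x : complexBetti (pad4Anchor E₀).X (2 * 4)} {q : ℚ} {μ : GaussianInt}
    (hx : x = ((q : ℚ) : ℂ) • cupPowTwo h 4 + F.wOf μ) :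
    cupProduct (d4j 1) x (cupPowTwo h 1) = ((q : ℚ) : ℂ) • cupPowTwo h 5 :=
  ShapeAt.cupProduct_hPow hE hψ hh hx one_pos

/-- **a shaped class with `x ∪ h = 0` has `q = 0`, i.e. is a Weil class** (for `h⁵ ≠ 0`): the Lefschetz shadow pins the
`ℚ[h]`-coordinate. -/
theorem ShapeAt.mem_weilClassesOf_of_cupProduct_h_eq_zero (hE : E₀.dim = 1) (hψ : ψ₀ ≫ ψ₀ = -(1 • 𝟙 E₀)) {F : WeilFrame E₀ ψ₀}
    {h : complexBetti (pad4Anchor E₀).X 2} (hh : h ∈ pullbackEigenclasses (pad4Anchor E₀) (pad4Action E₀ ψ₀) 2 (chi 1 1 1))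
    (h5 : cupPowTwo h 5 ≠ 0) {x : complexBetti (pad4Anchor E₀).X (2 * 4)} (hx : ShapeAt F h x)
    (h0 : cupProduct (d4j 1) x (cupPowTwo h 1) = 0) : x ∈ weilClassesOf (pad4Anchor E₀) (pad4Action E₀ ψ₀) 4 1 := by
  obtain ⟨q, μ, rfl⟩ := hx
  rw [ShapeAt.cupProduct_h hE hψ hh rfl] at h0
  have hq : ((q : ℚ) : ℂ) = 0 := (smul_eq_zero.mp h0).resolve_right h5
  rw [hq, zero_smul, zero_add]
  exact F.wOf_mem μ

/-- **THE DESIGN COORDINATES OF A SHAPED CLASS ARE WELL DEFINED**: for balanced `h` with `h⁴ ≠ 0`,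
`q·h⁴ + wOf μ = q'·h⁴ + wOf μ' ⟹ q = q' ∧ μ = μ'` — `(q − q')·h⁴ = wOf μ' − wOf μ` lies in `χ_{4,4} ∩ W = 0` (§16.2
`eq_zero_of_mem_chi_of_mem_weilClassesOf`), then `wOf` is injective. So the σ-check «the `μ` READ OFF `cl(Z)` equals the design's `μ`»
is a meaningful predicate on (design json, presentation): the pair `(q, μ)` of a shaped class is a FUNCTION of the class. -/
theorem ShapeAt.coords_unique (hψ : ψ₀ ≫ ψ₀ = -(1 • 𝟙 E₀)) {F : WeilFrame E₀ ψ₀} {h : complexBetti (pad4Anchor E₀).X 2}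
    (hh : h ∈ pullbackEigenclasses (pad4Anchor E₀) (pad4Action E₀ ψ₀) 2 (chi 1 1 1)) (h4 : cupPowTwo h 4 ≠ 0)
    {q q' : ℚ} {μ μ' : GaussianInt}
    (e : ((q : ℚ) : ℂ) • cupPowTwo h 4 + F.wOf μ = ((q' : ℚ) : ℂ) • cupPowTwo h 4 + F.wOf μ') : q = q' ∧ μ = μ' := by
  have _ := hψ
  have hdiff : (((q : ℚ) : ℂ) - ((q' : ℚ) : ℂ)) • cupPowTwo h 4 = F.wOf μ' - F.wOf μ := by
    rw [sub_smul, sub_eq_sub_iff_add_eq_add, e]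
    exact add_comm _ _
  have hχ : (((q : ℚ) : ℂ) - ((q' : ℚ) : ℂ)) • cupPowTwo h 4 ∈
      pullbackEigenclasses (pad4Anchor E₀) (pad4Action E₀ ψ₀) (2 * 4) (chi 1 4 4) :=
    Submodule.smul_mem _ _ (cupPowTwo_mem_chi hh 4)
  have hW : (((q : ℚ) : ℂ) - ((q' : ℚ) : ℂ)) • cupPowTwo h 4 ∈ weilClassesOf (pad4Anchor E₀) (pad4Action E₀ ψ₀) 4 1 := by
    rw [hdiff]
    exact Submodule.sub_mem _ (F.wOf_mem μ') (F.wOf_mem μ)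
  have h0 := eq_zero_of_mem_chi_of_mem_weilClassesOf one_pos (show 4 + 4 = 2 * 4 by norm_num) (by norm_num) (by norm_num) hχ hW
  have hq : ((q : ℚ) : ℂ) - ((q' : ℚ) : ℂ) = 0 := (smul_eq_zero.mp h0).resolve_right h4
  have hq' : q = q' := by exact_mod_cast sub_eq_zero.mp hq
  refine ⟨hq', (wOf_injective F ?_).symm⟩
  rw [h0] at hdiff
  exact (sub_eq_zero.mp hdiff.symm)

/-- **ALIVE ⟺ SHAPED AND NOT A MULTIPLE OF `h⁴`** (balanced `h`, `h⁴ ≠ 0`): on the C5 lattice «the class is the target Weil ∕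
non-divisor-power class» reads «`x ∉ ℚ·h⁴`», and by coordinate uniqueness that is «`μ ≠ 0`». -/
theorem aliveAt_iff_shapeAt_and_not_hPow (hψ : ψ₀ ≫ ψ₀ = -(1 • 𝟙 E₀)) {F : WeilFrame E₀ ψ₀}
    {h : complexBetti (pad4Anchor E₀).X 2} (hh : h ∈ pullbackEigenclasses (pad4Anchor E₀) (pad4Action E₀ ψ₀) 2 (chi 1 1 1))
    (h4 : cupPowTwo h 4 ≠ 0) (x : complexBetti (pad4Anchor E₀).X (2 * 4)) :
    AliveAt F h x ↔ ShapeAt F h x ∧ ∀ q' : ℚ, x ≠ ((q' : ℚ) : ℂ) • cupPowTwo h 4 := by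
  constructor
  · rintro ⟨q, μ, hμ, rfl⟩
    refine ⟨⟨q, μ, rfl⟩, fun q' e => hμ ?_⟩
    have e' : ((q : ℚ) : ℂ) • cupPowTwo h 4 + F.wOf μ = ((q' : ℚ) : ℂ) • cupPowTwo h 4 + F.wOf 0 := by
      rw [wOf_zero, add_zero]
      exact e
    exact (ShapeAt.coords_unique hψ hh h4 e').2
  · rintro ⟨⟨q, μ, rfl⟩, hne⟩
    refine ⟨q, μ, fun hμ => hne q ?_, rfl⟩
    rw [hμ, wOf_zero, add_zero]

/-- **THE SHAPE POLYNOMIAL KILLS A SHAPED CLASS** (exact, period-free `K`-test). For ONE test isogeny `T = (x₀·𝟙 + ψ)^*` on `H⁸(S⁴)`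
and the cubic `P_shape = (X − χ_{4,4}(x₀,1))·(X − χ_{8,0}(x₀,1))·(X − χ_{0,8}(x₀,1))`: `P_shape(T) x = 0` for every shaped `x`
(for `cl(Z)` this is a statement about three push–pull classes `T^i cl(Z)`, `i ≤ 3`, computable on the presentation). The converse
(«`P_shape(T)x = 0 ⟹ x ∈ χ_{4,4} ⊕ W`» for `x₀` separating the nine characters of degree `8`) is the coprime-kernel decomposition and is
not needed by the checker. [cite: Thomas2005Nodes, §4] [cite: vanGeemen1994HodgeAV, proof of Thm. 6.12] -/
theorem aeval_shapePoly_eq_zero_of_shapeAt (hψ : ψ₀ ≫ ψ₀ = -(1 • 𝟙 E₀)) {F : WeilFrame E₀ ψ₀}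
    {h : complexBetti (pad4Anchor E₀).X 2} (hh : h ∈ pullbackEigenclasses (pad4Anchor E₀) (pad4Action E₀ ψ₀) 2 (chi 1 1 1))
    {x : complexBetti (pad4Anchor E₀).X (2 * 4)} (hx : ShapeAt F h x) (x₀ : ℕ) :
    aeval (complexBetti.map (x₀ • 𝟙 (pad4Anchor E₀) + (1 : ℕ) • pad4Action E₀ ψ₀).hom.hom.hom (2 * 4)).hom
        ((X - C (chi 1 4 4 x₀ 1)) * ((X - C (chi 1 (2 * 4) 0 x₀ 1)) * (X - C (chi 1 0 (2 * 4) x₀ 1)))) x = 0 := by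
  have _ := hψ
  obtain ⟨q, μ, rfl⟩ := hx
  obtain ⟨w₁, hw₁, w₂, hw₂, hw⟩ := Submodule.mem_sup.mp (F.wOf_mem μ)
  rw [← hw]
  have e₁ := aeval_apply_of_mem_eigenspace'
    (pullbackEigenclasses_le_eigenspace (pad4Action E₀ ψ₀) (2 * 4) (chi 1 4 4) x₀ 1
      (Submodule.smul_mem _ ((q : ℚ) : ℂ) (cupPowTwo_mem_chi hh 4)))
    ((X - C (chi 1 4 4 x₀ 1)) * ((X - C (chi 1 (2 * 4) 0 x₀ 1)) * (X - C (chi 1 0 (2 * 4) x₀ 1))))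
  have e₂ := aeval_apply_of_mem_eigenspace'
    (pullbackEigenclasses_le_eigenspace (pad4Action E₀ ψ₀) (2 * 4) (chi 1 (2 * 4) 0) x₀ 1 (mem_chi_of_mem_weilClassesPlus hw₁))
    ((X - C (chi 1 4 4 x₀ 1)) * ((X - C (chi 1 (2 * 4) 0 x₀ 1)) * (X - C (chi 1 0 (2 * 4) x₀ 1))))
  have e₃ := aeval_apply_of_mem_eigenspace'
    (pullbackEigenclasses_le_eigenspace (pad4Action E₀ ψ₀) (2 * 4) (chi 1 0 (2 * 4)) x₀ 1 (mem_chi_of_mem_weilClassesMinus hw₂))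
    ((X - C (chi 1 4 4 x₀ 1)) * ((X - C (chi 1 (2 * 4) 0 x₀ 1)) * (X - C (chi 1 0 (2 * 4) x₀ 1))))
  rw [map_add, map_add, e₁, e₂, e₃]
  simp only [eval_mul, eval_sub, eval_X, eval_C, sub_self, zero_mul, mul_zero, zero_smul, add_zero]

/-- graded commutativity in even degrees on the anchor: `x ∪ y = y ∪ x` on `H⁸ × H⁸ → H¹⁶` (the tree's PROVED
`cupProduct_gradedComm_holds`, sign `(−1)^{64} = 1`). [cite: HatcherAT2002, Thm. 3.11] -/
theorem cupProduct_comm_H8 (x y : complexBetti (pad4Anchor E₀).X (2 * 4)) : cupProduct d448 x y = cupProduct d448 y x := by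
  rw [cupProduct_gradedComm_holds ℂ _ d448 d448 x y]
  norm_num

/-- **BLINDNESS OF THE NUMBERS TO SHAPE.** Let `σ = q·h⁴ + wOf μ` be a shaped class and `p ∈ H⁸(S⁴)` ANY class with `p ∪ h⁴ = 0`,
`p ∪ wOf μ = 0` and `p ∪ p = 0` (an isotropic `h⁴`-orthogonal class orthogonal to the design's Weil class — e.g. any isotropic vector of the
hyperplane `(h⁴)^⊥` of the `4900`-dimensional `χ_{4,4}`, which is `W`-orthogonal for free by §16.2, or ANY vector of a mixed summand
`χ_{a,b}`, `a ≠ b`, which is isotropic and kills `W` and `h⁴` for free by §16.1–§16.2: `mixed_blind_spot`). Then `σ' = σ + p` has THE SAME `h`-degree pairing `σ' ∪ h⁴ = σ ∪ h⁴` and THE SAME self-intersection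
`σ' ∪ σ' = σ ∪ σ`, but is NOT shaped unless `p ∈ ℚh⁴ ⊕ W`. Hence the seed record's numbers (`Z·h⁴`, `Z·Z`, `h⁸`; v12's degree sign and Gram
detector) can never certify SHAPE: it is a separate field of the record (critic w1), decided by the `K`-isotypic test plus ONE linear
identity in `χ_{4,4}` (`dim χ_{4,4} = 70² = 4900`), or — on the design road — inherited from `cl Z(s) = c₄(𝓔)` (v4 §9). -/
theorem numbers_blind_to_isotropic_primitive {h : complexBetti (pad4Anchor E₀).X 2} {σ p : complexBetti (pad4Anchor E₀).X (2 * 4)}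
    (hp₁ : cupProduct d448 p (cupPowTwo h 4) = 0) (hp₂ : cupProduct d448 σ p = 0) (hp₃ : cupProduct d448 p p = 0) :
    cupProduct d448 (σ + p) (cupPowTwo h 4) = cupProduct d448 σ (cupPowTwo h 4) ∧
      cupProduct d448 (σ + p) (σ + p) = cupProduct d448 σ σ := by
  refine ⟨by rw [LinearMap.map_add₂, hp₁, add_zero], ?_⟩
  rw [LinearMap.map_add₂, map_add, map_add, hp₂, hp₃, cupProduct_comm_H8 p σ, hp₂, add_zero, add_zero, add_zero]

/-- the hypothesis `σ ∪ p = 0` of the blindness lemma, discharged for a SHAPED `σ` from `p ⟂ h⁴` and `p ⟂ wOf μ`. -/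
theorem shaped_cupProduct_eq_zero_of_orthogonal {F : WeilFrame E₀ ψ₀} {h : complexBetti (pad4Anchor E₀).X 2}
    {σ p : complexBetti (pad4Anchor E₀).X (2 * 4)} {q : ℚ} {μ : GaussianInt} (hσ : σ = ((q : ℚ) : ℂ) • cupPowTwo h 4 + F.wOf μ)
    (hp₁ : cupProduct d448 p (cupPowTwo h 4) = 0) (hp₂ : cupProduct d448 p (F.wOf μ) = 0) : cupProduct d448 σ p = 0 := by
  rw [cupProduct_comm_H8 σ p, hσ, map_add, map_smul, hp₁, hp₂, smul_zero, add_zero]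

/-- **mixed summands are blind spots for free**: a class `p ∈ χ_{a,b} ⊆ H⁸(S⁴)`, `a + b = 8`, `a ≠ b`, `a, b ≥ 1`, kills `h⁴`, kills
`W`, and is isotropic (`χ_{a,b} ∪ χ_{a,b} ⊆ χ_{2a,2b}`, off-box since `max(2a, 2b) > 8`) — so `σ + p` has all the numbers of `σ`. -/
theorem mixed_blind_spot (hE : E₀.dim = 1) (hψ : ψ₀ ≫ ψ₀ = -(1 • 𝟙 E₀)) (F : WeilFrame E₀ ψ₀) (μ : GaussianInt)
    {h : complexBetti (pad4Anchor E₀).X 2} (hh : h ∈ pullbackEigenclasses (pad4Anchor E₀) (pad4Action E₀ ψ₀) 2 (chi 1 1 1))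
    {a b : ℕ} (hab : a + b = 2 * 4) (hne : a ≠ b) (ha : 0 < a) (hb : 0 < b) {p : complexBetti (pad4Anchor E₀).X (2 * 4)}
    (hp : p ∈ pullbackEigenclasses (pad4Anchor E₀) (pad4Action E₀ ψ₀) (2 * 4) (chi 1 a b)) :
    cupProduct d448 p (cupPowTwo h 4) = 0 ∧ cupProduct d448 p (F.wOf μ) = 0 ∧ cupProduct d448 p p = 0 := by
  have hA := pad4Anchor_dim hE
  have hφ := pad4Action_comp_self hψ
  refine ⟨?_, cupProduct_weil_eq_zero_of_mem_chi one_pos hφ hA d448 hab ha hb hp (F.wOf_mem μ), ?_⟩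
  · -- `p ∪ h⁴ ∈ χ_{a+4,b+4}`, off-box since `a ≠ b`, `a + b = 8`
    have hm := cupProduct_mem_chi d448 hp (cupPowTwo_mem_chi hh 4)
    exact eq_zero_of_mem_chi_offBox one_pos hφ (by omega) (by rcases Nat.lt_or_gt_of_ne hne with h | h <;> omega) hm
  · have hm := cupProduct_mem_chi d448 hp hp
    exact eq_zero_of_mem_chi_offBox one_pos hφ (by omega) (by rcases Nat.lt_or_gt_of_ne hne with h | h <;> omega) hm

end Shape

/-! ## §16.6 The ALIVE test `μ ≠ 0 ↔ σ ∪ σ ≠ q²·h⁸` under the NAMED anisotropy of the rational Weil plane (door) -/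

section Alive

variable {E₀ : AbelianVariety ℂ} {ψ₀ : E₀ ⟶ E₀}

/-- **`σ ∪ σ = q²·h⁸ + wOf μ ∪ wOf μ`** for `σ = q·h⁴ + wOf μ` and balanced `h`: the pairing on the C5 lattice `ℚ·h⁴ ⊕ W_K` is BLOCK
DIAGONAL (`h⁴ ∪ wOf μ = wOf μ ∪ h⁴ = 0`, §16.4). -/
theorem classC5_sq (hE : E₀.dim = 1) (hψ : ψ₀ ≫ ψ₀ = -(1 • 𝟙 E₀)) (F : WeilFrame E₀ ψ₀) (μ : GaussianInt) (q : ℚ)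
    {h : complexBetti (pad4Anchor E₀).X 2} (hh : h ∈ pullbackEigenclasses (pad4Anchor E₀) (pad4Action E₀ ψ₀) 2 (chi 1 1 1)) :
    cupProduct d448 (((q : ℚ) : ℂ) • cupPowTwo h 4 + F.wOf μ) (((q : ℚ) : ℂ) • cupPowTwo h 4 + F.wOf μ) =
      (((q ^ 2 : ℚ)) : ℂ) • cupPowTwo h 8 + cupProduct d448 (F.wOf μ) (F.wOf μ) := by
  rw [LinearMap.map_add₂, LinearMap.map_smul₂, map_add, map_add, map_smul, map_smul,
    hPow_cupProduct_hPow h (show 4 + 4 = 8 by norm_num) d448,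
    pad4_hPow_cupProduct_wOf_eq_zero hE hψ F μ (by norm_num : (0 : ℕ) < 4) d448 hh,
    pad4_wOf_cupProduct_hPow_eq_zero hE hψ F μ (by norm_num : (0 : ℕ) < 4) d448 hh,
    smul_zero, add_zero, zero_add, smul_smul, Rat.cast_pow, sq]

/-- **THE NAMED INPUT: anisotropy of the RATIONAL Weil plane** for the top pairing — `x ∪ x ≠ 0` for every non-zero RATIONAL Weil class
`x`. Source: the Weil classes are primitive (§16.3) of Hodge type `(4, 4)` (Weil type), so the Hodge–Riemann form `(x, y) ↦ ∫ x ∪ y` is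
DEFINITE (of sign `(−1)^{4}·… > 0`) on the real points `W_ℝ` of the rational plane `W_K`; a definite form is anisotropic. NOT proved
here (the tree has no `ℂ`-orientation ∕ HR comparison for `complexBetti`); it is the one door of this section, stated degree-functional-
free and orientation-free (weaker than v12's `hHR` positivity). [cite: VoisinHodgeI2002, Thm. 6.32] [cite: vanGeemen1994HodgeAV, Lemma 5.2, 5.8 and 6.10] -/
def WeilAnisotropic (E₀ : AbelianVariety ℂ) (ψ₀ : E₀ ⟶ E₀) : Prop :=
  ∀ x ∈ weilClassesOf (pad4Anchor E₀) (pad4Action E₀ ψ₀) 4 1, IsRationalClass x → x ≠ 0 → cupProduct d448 x x ≠ 0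

/-- under anisotropy: **`wOf μ ∪ wOf μ = 0 ↔ μ = 0`**. -/
theorem wOf_sq_eq_zero_iff (hW : WeilAnisotropic E₀ ψ₀) (F : WeilFrame E₀ ψ₀) (μ : GaussianInt) :
    cupProduct d448 (F.wOf μ) (F.wOf μ) = 0 ↔ μ = 0 := by
  constructor
  · intro h0
    by_contra hμ
    exact hW _ (F.wOf_mem μ) (F.wOf_rational μ) (F.wOf_ne_zero hμ) h0
  · rintro rfl
    simp only [wOf_zero, map_zero]

/-- **THE ALIVE TEST AT THE SEED (door): `μ ≠ 0 ↔ σ ∪ σ ≠ q²·h⁸`** for `σ = q·h⁴ + wOf μ`, balanced `h`, under `WeilAnisotropic` —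
the design half of C5 read from the self-intersection of the seed's class against `q²·h⁸` (two entries of the seed record), with NO
orientation, NO degree functional and NO `h⁸ ≠ 0` (contrast v12 §15.7). For `σ = r·cl(Z)`: `Z·Z ≠ (q/r)²·h⁸`. -/
theorem mu_ne_zero_iff_sq_ne (hE : E₀.dim = 1) (hψ : ψ₀ ≫ ψ₀ = -(1 • 𝟙 E₀)) (hW : WeilAnisotropic E₀ ψ₀) (F : WeilFrame E₀ ψ₀)
    (μ : GaussianInt) (q : ℚ) {h : complexBetti (pad4Anchor E₀).X 2}
    (hh : h ∈ pullbackEigenclasses (pad4Anchor E₀) (pad4Action E₀ ψ₀) 2 (chi 1 1 1)) :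
    μ ≠ 0 ↔ cupProduct d448 (((q : ℚ) : ℂ) • cupPowTwo h 4 + F.wOf μ) (((q : ℚ) : ℂ) • cupPowTwo h 4 + F.wOf μ) ≠
      (((q ^ 2 : ℚ)) : ℂ) • cupPowTwo h 8 := by
  rw [classC5_sq hE hψ F μ q hh, Ne, Ne, add_eq_left, wOf_sq_eq_zero_iff hW F μ]

/-- the instance for the stub's `h_K = symH ψ e a` of a kit and the class of `ClassCheck K μ i q`. -/
theorem mu_ne_zero_iff_sq_ne_symH (hE : E₀.dim = 1) (hψ : ψ₀ ≫ ψ₀ = -(1 • 𝟙 E₀)) (hW : WeilAnisotropic E₀ ψ₀) (K : AnchorKit E₀ ψ₀)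
    (μ : GaussianInt) (q : ℚ) :
    μ ≠ 0 ↔ cupProduct d448 (((q : ℚ) : ℂ) • cupPowTwo (symH (pad4Action E₀ ψ₀) K.pol.e K.pol.a) 4 + K.F.wOf μ)
        (((q : ℚ) : ℂ) • cupPowTwo (symH (pad4Action E₀ ψ₀) K.pol.e K.pol.a) 4 + K.F.wOf μ) ≠
      (((q ^ 2 : ℚ)) : ℂ) • cupPowTwo (symH (pad4Action E₀ ψ₀) K.pol.e K.pol.a) 8 :=
  mu_ne_zero_iff_sq_ne hE hψ hW K.F μ q (symH_mem_chi hψ K.pol.e K.pol.a)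

/-- **signed version (door)**: under Hodge–Riemann POSITIVITY of the rational Weil plane relative to `h⁸` — `x ∪ x = r·h⁸` with
`r > 0` for rational `x ∈ W ∖ 0` — the self-intersection of an ALIVE class EXCEEDS its `ℚ[h]`-part: `σ ∪ σ = (q² + r)·h⁸`, `r > 0`. -/
theorem classC5_sq_of_HR (hE : E₀.dim = 1) (hψ : ψ₀ ≫ ψ₀ = -(1 • 𝟙 E₀)) {h : complexBetti (pad4Anchor E₀).X 2}
    (hh : h ∈ pullbackEigenclasses (pad4Anchor E₀) (pad4Action E₀ ψ₀) 2 (chi 1 1 1))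
    (hHR : ∀ x ∈ weilClassesOf (pad4Anchor E₀) (pad4Action E₀ ψ₀) 4 1, IsRationalClass x → x ≠ 0 →
      ∃ r : ℝ, 0 < r ∧ cupProduct d448 x x = (r : ℂ) • cupPowTwo h 8)
    (F : WeilFrame E₀ ψ₀) {μ : GaussianInt} (hμ : μ ≠ 0) (q : ℚ) :
    ∃ r : ℝ, 0 < r ∧ cupProduct d448 (((q : ℚ) : ℂ) • cupPowTwo h 4 + F.wOf μ) (((q : ℚ) : ℂ) • cupPowTwo h 4 + F.wOf μ) =
      ((((q ^ 2 : ℚ) : ℝ) + r : ℝ) : ℂ) • cupPowTwo h 8 := by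
  obtain ⟨r, hr, hx⟩ := hHR _ (F.wOf_mem μ) (F.wOf_rational μ) (F.wOf_ne_zero hμ)
  refine ⟨r, hr, ?_⟩
  rw [classC5_sq hE hψ F μ q hh, hx, ← add_smul]
  congr 1
  push_cast
  ring

end Alive

end Summit.HodgeConjecture.HodgeConjecture.Cruxes.BlochSeedDiscOne.SeedChecker.Primitive

end
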